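import Summits.AtomisticToContinuum.BoseEinsteinCondensation.Theses.BECRewardDescent
import Summits.AtomisticToContinuum.BoseEinsteinCondensation.Theorems.BECRewardDescentWalkGlueCurve
import Summits.AtomisticToContinuum.BoseEinsteinCondensation.Theorems.BECRewardDescentWalkGlueBootstrap
import Summits.AtomisticToContinuum.BoseEinsteinCondensation.Theorems.BECRewardDescentRewardChordBoundChordFromModulus
import Summits.AtomisticToContinuum.BoseEinsteinCondensation.Theorems.BECRewardDescentRewardScaleChord

/-!
# Crux `RewardChordBound` (stmt-AtomisticToContinuum-12876) — ALTERNATIVE line `dyadic-secant`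
# (strategist `cstrat-stmt-AtomisticToContinuum-12876-s1`, 2026-08-17; registered BESIDE `Lines/birth.lean`, never over it)

Route `route-AtomisticToContinuum-BECRewardDescent`, sub-problem `BoseEinsteinCondensation`, crux decl
`Summit.AtomisticToContinuum.BoseEinsteinCondensation.Theses.BECRewardDescent.RewardChordBound` (the reward walk:
`chord(s) ≤ chord(s₀) + τN` for the reward curve `R(t) = inf_Ψ ⟨Ψ,HΨ⟩ + t(N − n₀(Ψ))`, `0 < s ≤ s₀ = θρa`, at low
density, eventually in `N`).

## Why a second line

The live line (`Lines/birth.lean`, lead `line-stmt-AtomisticToContinuum-12876-c2`) is sorry-free except for its two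
EXTERNAL stubs `stub_sectorGap : SectorGap` (item 12874) and `stub_condensateVariance : CondensateVariance` (item
12875): kernel-checked, `RewardChordBound ⇐ SectorGap ∧ CondensateVariance` (Reduction file, p157205; hard-core
Perron–Frobenius kernel p164975). The lead is therefore `blocked-on` two Bogoliubov-type SPECTRAL statements in the
thermodynamic frame (a `P = 0` Ky-Fan gap `c√(ρa s)` and a variance bound `Var n̂₀ ≤ CN` for condensed
near-minimisers, at every reward `s ∈ (0, ρa]`, uniformly in `N`). The walk, however, CONSUMES much less than a gap
and a variance: it consumes a bound on the CURVATURE MASS of the concave curve `R` on dyadic reward shells. This line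
re-cuts the crux at exactly that quantity and, in doing so, drops every spectral object of the live line (no Ky-Fan
gap, no variance, no simplicity / Perron–Frobenius of the rewarded ground state, no "no kink", no differentiability,
no `h → 0⁺` Temple denominator `g − 2hN`).

## The line: a discrete renormalisation walk in the reward cut-off

The reward `t·n̂₊` gaps every one-particle mode `p ≠ 0` by `t`; in Bogoliubov's picture the rewarded gas at reward
`t` is MASSIVE with phonon threshold `√(t(t + 16πρa))`, i.e. the reward is an infrared cut-off at momentum `√t`.
Halving the reward is one RG step (one momentum shell `[√u, √(4u)]`). The walk is the induction over the shells; the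
open input is the ONE-SHELL estimate.

* `stub_shellModulus` (OPEN, the load-bearing stub; physics): at low density, eventually in `N`, for every shell
  `(u, 4u] ⊂ (0, ρa]`: IF the near-minimisers of the rewarded functional `F_w` are `(1−η)`-condensed at every reward
  `w` of the UPPER half-shell `(2u, 4u]`, THEN the three rewarded ground-state energies at rewards `u, 2u, 4u` are
  almost collinear from below: `3R(2u) ≤ 2R(u) + R(4u) + K·N·u·√(u/(ρa))`. Equivalently: the secant slope of `R`
  on `[u, 2u]` exceeds the one on `[2u, 4u]` by at most `(K/2)N√(u/(ρa))` — the depletion gained by lowering the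
  cut-off through one shell is `O(N√(u/ρa))` (Bogoliubov predicts `O(N u √(a/ρ) log(ρa/u))`, smaller by the
  factor `√(u a²) log(ρa/u) ≲ √(ρa³)`; the allowance is summable over dyadic shells: `∑ₖ √(s₀4^{-k}/(ρa)) = 2√θ`). The hypothesis sits
  on the upper half-shell ONLY, so the statement also forbids a macroscopic level crossing at the middle reward
  `2u` (jump of `R'` larger than `(K/2)N√(u/ρa)`) given condensation just above it — Nozières' exchange argument
  against fragmentation is the heuristic; the stub is its quantitative, one-shell, finite-`N` form.
* `stub_secantWalk` (real analysis on an infimum of affine functions in `ℝ≥0∞`, provable now from the landed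
  WalkGlue kit `concaveOn_toReal_iInf_affine`, `continuousWithinAt_toReal_iInf_affine`, Griffiths' lemmas
  `near_min_le_leftDeriv_add` / `rightDeriv_sub_le_near_min`, `slope_le_of_ennreal_rung`, `ennreal_chord_of_real_chord`):
  for `η, K, τ > 0` there is `θ ∈ (0, 1/4]` such that for every affine family `Eᵢ + t·Dᵢ` (`Dᵢ ≤ N`, `⨅E < ∞`) with
  the rung `chord(θρa) ≤ (η/4)N` and the one-shell estimate available on every shell `(u,4u] ⊂ (0, ρa]` whose upper
  half carries condensed near-minimisers, `chord(s) ≤ chord(θρa) + τN` on `(0, θρa]`. Proof sketch (real induction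
  DOWNWARD on the left derivative `D⁻ = R'₋`, which is non-increasing and left-continuous): let
  `s* = sup {w ≤ s₀ : D⁻(w) ≥ ηN}`; above `s*` near-minimisers are condensed (Griffiths: their depletion is
  `≤ D⁻(w) + o(1)`), so the shell estimate fires on every shell with `2u ≥ s*`; chaining the shells
  `u = s*/2, s*, 2s*, …` up to `s₀` gives `D⁻(s*) ≤ σ(s*/2, s*) ≤ 2·chord(s₀) + (K/2)N ∑ √(u/ρa) ≤ ηN/2 + K√θ·N < ηN`
  for `θ` small — contradiction, so `s*` does not exist; then the dyadic chain anchored at `s₀`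
  (`σ(s₀/2, s₀) ≤ chord(s₀)`) bounds `R'(0⁺) = lim σ(s₀2^{-k-1}, s₀2^{-k}) ≤ chord(s₀) + 0.86·K√θ·N ≤ chord(s₀) + τN`,
  and `chord(s) ≤ R'(0⁺)`.
* `RewardChordBound_of` (composition, no `sorry` of its own): `η, K, ρ₁` from the shell stub; `θ(η, K, τ)` from the
  walk; the PROVED rung `Theorems.rewardScaleChord_proof v hv (η/4) θ` (item 12877) and `PeriodicEnergyFinite_holds`;
  `ρ₀ := min ρ₁ ρ₃ ρ₄`; intersection of the three eventual sets; the walk instantiated at `Eᵢ = ⟨Ψ,HΨ⟩`,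
  `Dᵢ = N − n₀(Ψ)`, `P = ((1−η)N ≤ n₀(Ψ))` (`ChordFromModulus.condensed_of_depletion_lt`).

Relation to the live line: `SectorGap ∧ CondensateVariance` give, through the landed `stub_modulusOfSimple`, the
POINTWISE curvature bound `−R'' ≤ 2CN/(c√(ρa u))` wherever near-minimisers are condensed; integrated over a shell this
is the one-shell estimate with `K = 8C/c` when condensation is known on the whole shell. The shell stub asks for it
with condensation known on the upper half-shell only (that is what makes the discrete bootstrap close without
"no kink"), and it asks for nothing pointwise, nothing spectral and nothing about simplicity of ground states.

Disproof used: none exists for this crux (`ledger crux ls`, 2026-08-17: no `Disproof.lean`). Item evidence honoured: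
rattack-12876 (`RewardChordBound` restates complete torus BEC modulo rung 1; `τ ≥ 1` trivial; `v = 0` vacuous — here
`a = 0` makes `4u ≤ ρa` unsatisfiable, so the shell stub is vacuous exactly where the crux is); grounder verdict
(open-problem: the `s → 0⁺` / `N → ∞` interchange) — it lives in the shell stub at shells `u → 0⁺`, uniformly in `N`,
and nowhere else.
-/

namespace Summit.AtomisticToContinuum.BoseEinsteinCondensation.Cruxes.RewardChordBound.DyadicSecant

open scoped BigOperators Topology Classical ENNReal
open Filter Set

/-- **stub 1 — `ShellModulus` (OPEN; the one-shell estimate of the reward RG).** For every repulsive finite-range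
`v` there are `η, K, ρ₀ > 0` and a shell ceiling `σ ∈ (0, 1]` such that for `0 < ρ < ρ₀`, eventually in `N`, for every
reward shell `(u, 4u]` with `4u ≤ σρa`: if at every reward `w ∈ (2u, 4u]` the near-minimisers of
`F_w = ⟨·,H·⟩ + w(N − n̂₀)` (at some precision `δ > 0`) are `(1−η)`-condensed, then `3R(2u) ≤ 2R(u) + R(4u) + K N u √(u/(ρa))` for the reward infimum
`R(t) = inf_Ψ F_t(Ψ)` on the periodic box of side `(N/ρ)^{1/3}`. Three rewarded (gapped) ground-state energies per
shell; no gap, variance, simplicity or derivative enters. Why it might fail: at shells `u → 0⁺` (with `N → ∞` first)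
it forbids fragmented competitors with `≳ N√(u/ρa)` extra depleted particles within rewarded energy `O(Nu^{3/2}/√(ρa))`
of optimal — the infrared content of torus BEC, in one-shell form. [cite: LSSY2005, Ch. 5 §5.1 and App. D]
[cite: Griffiths1966] [cite: LiebSeiringerYngvason2005] -/
theorem stub_shellModulus :
    ∀ v : ℝ → ENNReal, Literature.MathematicalPhysics.QuantumManyBody.BoseGas.IsRepulsiveFiniteRange v →
      ∃ η K σ ρ₀ : ℝ, 0 < η ∧ 0 < K ∧ 0 < σ ∧ σ ≤ 1 ∧ 0 < ρ₀ ∧ ∀ ρ : ℝ, 0 < ρ → ρ < ρ₀ → ∀ᶠ N : ℕ in Filter.atTop,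
        ∀ u : ℝ, 0 < u → 4 * u ≤ σ * ρ * (Literature.MathematicalPhysics.QuantumManyBody.BoseGas.scatteringLength v).toReal →
          (∀ w : ℝ, 2 * u < w → w ≤ 4 * u → ∃ δ : ENNReal, 0 < δ ∧
            ∀ Ψ : Literature.MathematicalPhysics.QuantumManyBody.BoseGas.PeriodicTrialState N
              (Literature.MathematicalPhysics.QuantumManyBody.BoseGas.sideLength ρ N),
              Literature.MathematicalPhysics.QuantumManyBody.BoseGas.periodicEnergy v Ψ + ENNReal.ofReal w *
                  ((N : ENNReal) - Literature.MathematicalPhysics.QuantumManyBody.BoseGas.condensateOccupation N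
                    (Literature.MathematicalPhysics.QuantumManyBody.BoseGas.sideLength ρ N) Ψ.ψ) ≤
                (⨅ Ψ' : Literature.MathematicalPhysics.QuantumManyBody.BoseGas.PeriodicTrialState N
                  (Literature.MathematicalPhysics.QuantumManyBody.BoseGas.sideLength ρ N),
                  (Literature.MathematicalPhysics.QuantumManyBody.BoseGas.periodicEnergy v Ψ' + ENNReal.ofReal w *
                    ((N : ENNReal) - Literature.MathematicalPhysics.QuantumManyBody.BoseGas.condensateOccupation N
                      (Literature.MathematicalPhysics.QuantumManyBody.BoseGas.sideLength ρ N) Ψ'.ψ))) + δ →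
              ENNReal.ofReal ((1 - η) * N) ≤
                Literature.MathematicalPhysics.QuantumManyBody.BoseGas.condensateOccupation N
                  (Literature.MathematicalPhysics.QuantumManyBody.BoseGas.sideLength ρ N) Ψ.ψ) →
          3 * (⨅ Ψ : Literature.MathematicalPhysics.QuantumManyBody.BoseGas.PeriodicTrialState N
              (Literature.MathematicalPhysics.QuantumManyBody.BoseGas.sideLength ρ N),
              (Literature.MathematicalPhysics.QuantumManyBody.BoseGas.periodicEnergy v Ψ + ENNReal.ofReal (2 * u) *
                ((N : ENNReal) - Literature.MathematicalPhysics.QuantumManyBody.BoseGas.condensateOccupation N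
                  (Literature.MathematicalPhysics.QuantumManyBody.BoseGas.sideLength ρ N) Ψ.ψ))) ≤
            2 * (⨅ Ψ : Literature.MathematicalPhysics.QuantumManyBody.BoseGas.PeriodicTrialState N
                (Literature.MathematicalPhysics.QuantumManyBody.BoseGas.sideLength ρ N),
                (Literature.MathematicalPhysics.QuantumManyBody.BoseGas.periodicEnergy v Ψ + ENNReal.ofReal u *
                  ((N : ENNReal) - Literature.MathematicalPhysics.QuantumManyBody.BoseGas.condensateOccupation N
                    (Literature.MathematicalPhysics.QuantumManyBody.BoseGas.sideLength ρ N) Ψ.ψ))) +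
              (⨅ Ψ : Literature.MathematicalPhysics.QuantumManyBody.BoseGas.PeriodicTrialState N
                (Literature.MathematicalPhysics.QuantumManyBody.BoseGas.sideLength ρ N),
                (Literature.MathematicalPhysics.QuantumManyBody.BoseGas.periodicEnergy v Ψ + ENNReal.ofReal (4 * u) *
                  ((N : ENNReal) - Literature.MathematicalPhysics.QuantumManyBody.BoseGas.condensateOccupation N
                    (Literature.MathematicalPhysics.QuantumManyBody.BoseGas.sideLength ρ N) Ψ.ψ))) +
              ENNReal.ofReal (K * N * u * Real.sqrt (u / (ρ *
                (Literature.MathematicalPhysics.QuantumManyBody.BoseGas.scatteringLength v).toReal))) := by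
  sorry

/-- **stub 2 — `SecantWalk` (the discrete reward walk; real analysis, provable now from the WalkGlue kit).**
For `η, K, τ > 0` and `σ ∈ (0, 1]` there is `θ ∈ (0, σ/4]` such that for every family `i ↦ Eᵢ + t·Dᵢ` in `ℝ≥0∞`
with `Dᵢ ≤ N`, `⨅ Eᵢ < ∞`, reward curve `R(t) = ⨅ᵢ (Eᵢ + t·Dᵢ)` and a predicate `P` implied by `Dᵢ < ηN`: IF (rung)
`R(s₀) ≤ ⨅E + s₀(η/4)N` at `s₀ = θρa` and (shells) for every `u` with `4u ≤ σρa`, whenever for each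
`w ∈ (2u, 4u]` the near-minimisers of `Eᵢ + w·Dᵢ` satisfy `P` one has `3R(2u) ≤ 2R(u) + R(4u) + KNu√(u/(ρa))`,
THEN `R(s) + (s/s₀)⨅E ≤ ⨅E + (s/s₀)R(s₀) + sτN` on `(0, s₀]`. Proof: downward real induction on the left
derivative of the concave real curve (Griffiths' lemma turns `R'₋(w) < ηN` into `P` for near-minimisers at `w`;
the shell chain anchored at the frontier `s*` bounds `R'₋(s*)` by `2·chord(s₀) + K√θ N < ηN`), then the dyadic
chain anchored at `s₀` bounds `R'(0⁺) ≤ chord(s₀) + 0.86 K√θ N` and `chord(s) ≤ R'(0⁺)`; `N = 0`: `R` is constant.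
[cite: Griffiths1966] [cite: Kato1966, VII §3] -/
theorem stub_secantWalk :
    ∀ (η K τ σ : ℝ), 0 < η → 0 < K → 0 < τ → 0 < σ → σ ≤ 1 → ∃ θ : ℝ, 0 < θ ∧ θ ≤ σ / 4 ∧
      ∀ (ι : Type) (E D : ι → ENNReal) (P : ι → Prop) (Rₑ : ℝ → ENNReal) (N : ℕ) (ρ a : ℝ),
        (∀ t : ℝ, Rₑ t = ⨅ i, (E i + ENNReal.ofReal t * D i)) → (∀ i, D i ≤ (N : ENNReal)) →
        (⨅ i, E i) ≠ ⊤ → (∀ i, D i < ENNReal.ofReal (η * N) → P i) →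
        (0 < θ * ρ * a → Rₑ (θ * ρ * a) ≤ (⨅ i, E i) + ENNReal.ofReal (θ * ρ * a * (η / 4) * N)) →
        (∀ u : ℝ, 0 < u → 4 * u ≤ σ * ρ * a →
          (∀ w : ℝ, 2 * u < w → w ≤ 4 * u → ∃ δ : ENNReal, 0 < δ ∧
            ∀ i, E i + ENNReal.ofReal w * D i ≤ Rₑ w + δ → P i) →
          3 * Rₑ (2 * u) ≤ 2 * Rₑ u + Rₑ (4 * u) + ENNReal.ofReal (K * N * u * Real.sqrt (u / (ρ * a)))) →
        ∀ s : ℝ, 0 < s → s ≤ θ * ρ * a →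
          Rₑ s + ENNReal.ofReal (s / (θ * ρ * a)) * (⨅ i, E i) ≤
            (⨅ i, E i) + ENNReal.ofReal (s / (θ * ρ * a)) * Rₑ (θ * ρ * a) + ENNReal.ofReal (s * τ * N) := by
  sorry

open Literature.MathematicalPhysics.QuantumManyBody.BoseGas in
/-- **Composition.** `RewardChordBound` (the route decl, BY NAME) from the two stubs BY NAME and the route's proved
items `RewardScaleChord` (`Theorems.rewardScaleChord_proof`, item 12877) and `PeriodicEnergyFinite`
(`PeriodicEnergyFinite_holds`); no `sorry` of its own. -/
theorem RewardChordBound_of :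
    Summit.AtomisticToContinuum.BoseEinsteinCondensation.Theses.BECRewardDescent.RewardChordBound := by
  intro v hv τ hτ
  obtain ⟨η, K, σ, ρ₁, hη, hK, hσ, hσ1, hρ₁, hS⟩ := stub_shellModulus v hv
  obtain ⟨θ, hθ, hθ4, hW⟩ := stub_secantWalk η K τ σ hη hK hτ hσ hσ1
  obtain ⟨ρ₃, hρ₃, hR1⟩ :=
    Summit.AtomisticToContinuum.BoseEinsteinCondensation.Theorems.rewardScaleChord_proof v hv (η / 4) θ
      (by positivity) hθ
  obtain ⟨ρ₄, hρ₄, hFin⟩ :=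
    Summit.AtomisticToContinuum.BoseEinsteinCondensation.Theses.BECRewardDescent.PeriodicEnergyFinite_holds v hv
  refine ⟨θ, min ρ₁ (min ρ₃ ρ₄), hθ, lt_min hρ₁ (lt_min hρ₃ hρ₄), fun ρ hρ hρlt => ?_⟩
  have h1 : ρ < ρ₁ := lt_of_lt_of_le hρlt (min_le_left _ _)
  have h3 : ρ < ρ₃ := lt_of_lt_of_le hρlt ((min_le_right _ _).trans (min_le_left _ _))
  have h4 : ρ < ρ₄ := lt_of_lt_of_le hρlt ((min_le_right _ _).trans (min_le_right _ _))
  filter_upwards [hS ρ hρ h1, hR1 ρ hρ h3, hFin ρ hρ h4] with N hSN hRN hFN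
  intro s hs hsle
  exact hW (PeriodicTrialState N (sideLength ρ N)) (fun Ψ => periodicEnergy v Ψ)
    (fun Ψ => (N : ℝ≥0∞) - condensateOccupation N (sideLength ρ N) Ψ.ψ)
    (fun Ψ => ENNReal.ofReal ((1 - η) * N) ≤ condensateOccupation N (sideLength ρ N) Ψ.ψ)
    (fun t => ⨅ Ψ : PeriodicTrialState N (sideLength ρ N), (periodicEnergy v Ψ +
      ENNReal.ofReal t * ((N : ℝ≥0∞) - condensateOccupation N (sideLength ρ N) Ψ.ψ)))
    N ρ _ (fun _ => rfl) (fun _ => tsub_le_self) hFN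
    (fun Ψ h =>
      Summit.AtomisticToContinuum.BoseEinsteinCondensation.Cruxes.RewardChordBound.Birth.ChordFromModulus.condensed_of_depletion_lt
        hη.le h)
    (fun hpos => hRN _ hpos le_rfl) (fun u hu h4u hcond => hSN u hu h4u hcond) s hs hsle

end Summit.AtomisticToContinuum.BoseEinsteinCondensation.Cruxes.RewardChordBound.DyadicSecant
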